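import Literature.NumberTheory.EllipticCurves.Rank1Residual.X12SexticTwistTransportClosed
import Summits.BirchSwinnertonDyer.Rank1Residual.X2.TwistMinimal
import Summits.BirchSwinnertonDyer.Rank1Residual.X12.InertCoreInstancesA
import Literature.NumberTheory.QuadraticFields.FundamentalDiscriminantResolvent
import HarnessLib

/-!
# X12, `p = 3`, `j = 0`: Kriz–Li's sextic-twist family over `ℚ` — PREPARATIONS
# (bad primes of `E_d`; the twisted equation is `3`-minimal; small bookkeeping)
# (cell `b2b-bsdres`, unit `b2b-bsdres-x1b` = X12 prover owner, gen 17; harvest-2 HARVEST E55)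

HONEST FRAMING (run/shared/lean/b2b/bsd-rank1-residual/, verbatim in every file): the goal of the
cell is to DELETE the COMBINATION-SHAPED residual classes of the Birch–Swinnerton-Dyer formula for
ALL analytic-rank `≤ 1` elliptic curves over `ℚ` — "full BSD formula for every rank `≤ 1` curve in
class `C`" assembled STRICTLY from published theorems — so that the rank-`≤ 1` remainder becomes
exactly the CONSTRUCTION-SHAPED classes, which are TYPED (missing-input `Prop`s), NOT attempted.
This is not "finishing BSD". Research route on the CONSTRUCTION-SHAPED class X12; no claim beyond
the stated sub-family; no label change. THEOREMS ONLY (no definition, no named fact): elementary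
local arithmetic of the sextic twists `E_d : y² = x³ − 432d` (`d` a fundamental discriminant) used
by the family theorem `X12/SexticTwistFamily.lean` to discharge, for EVERY `d`, the per-pair inputs
of harvest-2's descent `KrizLi2019.bsdp_three_of_thm1010`:

* §1 `dvd_conductorNorm_of_dvd`: every prime `ℓ ∣ d` divides the conductor of any model
  `W ≅_ℚ E_d` — `Δ(E_d) = −2¹²3⁹d² = u⁻¹²·Δ_min(W)` with `12 ∤ ord_ℓ(2¹²3⁹d²)` (`2`, `11`, `16` or
  `18`), so `ℓ ∣ Δ_min(W)` (Silverman VII.1.3(b), VII.5.1(a)); hence Heegner for `3N(E_d)` implies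
  Heegner for `3|d|` (`satisfiesHeegnerHypothesis_three_mul_natAbs`) — the printed sentence "`E_d`
  has additive reduction exactly at the prime factors of `3d`" (Kriz–Li §10.2), inclusion `⊇`.
* §2 `padicValRat_u_eq_zero_of_smul_quadraticTwist`: for `3 ∤ D` and ANY globally minimal
  `Wd = Cd • W^{(D)}`, `ord₃ u(Cd) = 0` — the twisted equation (Silverman X.5.4's model, the tree's
  `quadraticTwist`) is `3`-integral with `ord₃ Δ = ord₃ Δ(W) ≤ 11`, hence `3`-minimal (AEC VII.1
  Rem. 1.1, tree `isMinimalAt_of_lt_valuation_Δ_holds`), and two `3`-minimal equations differ by a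
  `3`-adic unit (AEC VII.1.3(b); eisenstein-p2's `X2.valuation_u_eq_one_of_isMinimalAt_smul`,
  `X2.padicValRat_eq_zero_of_valuation_eq_one`) — side condition (ii) of the descent.
* §3 `W ≅ E_d` has CM (`c₄ = 0`); `3` split in `K` ⇒ `3 ∤ d_K`, `3 ∤ #μ(K)` (side
  condition (iii); harvest-1's `X12SexticTwist.not_three_dvd_torsionOrder`).

References: [SilvermanAEC2009] VII.1 Prop. 1.3(b), Rem. 1.1, VII.5 Prop. 5.1(a), VIII.8, X.5.4;
[KrizLi2019] §10.2; [Cox2013] §7.A; HOME/b2b-bsdres-x1b/X12-ROUTE.md §21.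
-/

noncomputable section

open scoped Classical NumberField

open WeierstrassCurve NumberField IsDedekindDomain Literature.NumberTheory.EllipticCurves
  Literature.NumberTheory.EllipticCurves.ModularForms
  Literature.NumberTheory.EllipticCurves.KrizLi2019
  Literature.NumberTheory.EllipticCurves.Rank1Residual
  Literature.NumberTheory.EllipticCurves.Rank1Residual.X12SexticTwist

namespace Summit.BirchSwinnertonDyer.Rank1Residual.X12.SexticTwistFamily

/-! ### §1. The bad primes of `E_d`: every prime of `d` divides the conductor -/

/-- **A prime at which an integral model's discriminant has valuation not divisible by `12` is
bad.** If `W/ℚ` is globally minimal and `C • W` has discriminant `M ∈ ℤ` with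
`12 ∤ ord_ℓ M`, then `ℓ ∣ Δ_min(W)`: indeed `M = u⁻¹² Δ_min(W)` in `ℚ`, so `ℓ ∤ Δ_min(W)` would
give `ord_ℓ M = 12 · ord_ℓ u⁻¹`. [cite: SilvermanAEC2009, VII.1 Prop. 1.3(b) and Table 1.2] -/
theorem dvd_minimalDiscriminantInt_of_smul_Δ_eq (W : WeierstrassCurve ℚ) [W.IsElliptic]
    [W.IsGloballyMinimal] (C : VariableChange ℚ) {M : ℤ} (hM : (C • W).Δ = (M : ℚ))
    (ℓ : ℕ) [Fact ℓ.Prime] (h12 : ¬ 12 ∣ padicValInt ℓ M) :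
    (ℓ : ℤ) ∣ minimalDiscriminantInt W := by
  by_contra hnd
  have hΔ : (M : ℚ) = ((C.u⁻¹ : ℚˣ) : ℚ) ^ 12 * (minimalDiscriminantInt W : ℚ) := by
    rw [← hM, cast_minimalDiscriminantInt, variableChange_Δ]
  have hDm0 : (minimalDiscriminantInt W : ℚ) ≠ 0 := by
    exact_mod_cast minimalDiscriminantInt_ne_zero W
  have hu0 : ((C.u⁻¹ : ℚˣ) : ℚ) ≠ 0 := Units.ne_zero _
  have hv := congrArg (padicValRat ℓ) hΔ
  rw [padicValRat.of_int, padicValRat.mul (pow_ne_zero _ hu0) hDm0, padicValRat.pow,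
    padicValRat.of_int, padicValInt.eq_zero_of_not_dvd hnd] at hv
  apply h12
  push_cast at hv
  have h12' : (12 : ℤ) ∣ (padicValInt ℓ M : ℤ) := ⟨padicValRat ℓ ((C.u : ℚ)⁻¹), by linarith⟩
  exact_mod_cast h12'

/-- The discriminant of the displayed model: `Δ(y² = x³ − 432d) = −2¹²·3⁹·d²`. [folklore] -/
theorem Δ_sexticModel (d : ℤ) :
    (({ a₁ := 0, a₂ := 0, a₃ := 0, a₄ := 0, a₆ := -432 * d } : WeierstrassCurve ℚ)).Δ =
      ((-(2 ^ 12 * 3 ^ 9 * d ^ 2) : ℤ) : ℚ) := by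
  rw [(Δ_c₄_mordell (-432 * (d : ℚ))).1]
  push_cast
  ring

/-- `ord_ℓ` of a squarefree integer at a prime divisor is `1`. [folklore] -/
theorem padicValNat_natAbs_eq_one_of_squarefree {m : ℤ} (hm : Squarefree m) (ℓ : ℕ) [hℓ : Fact ℓ.Prime]
    (hdvd : (ℓ : ℤ) ∣ m) : padicValNat ℓ m.natAbs = 1 := by
  have hm0 : m.natAbs ≠ 0 := Int.natAbs_ne_zero.mpr hm.ne_zero
  have h1 : 1 ≤ padicValNat ℓ m.natAbs :=
    one_le_padicValNat_of_dvd hm0 (Int.natCast_dvd.mp (by simpa using hdvd))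
  have h2 : ¬ 2 ≤ padicValNat ℓ m.natAbs := by
    intro h
    have hsq : ℓ ^ 2 ∣ m.natAbs := (padicValNat_dvd_iff_le hm0).mpr h
    have hsq' : (ℓ : ℤ) * ℓ ∣ m := by
      rw [← sq]
      have := Int.natCast_dvd.mpr hsq
      simpa using this
    have hu := hm (ℓ : ℤ) hsq'
    rw [Int.isUnit_iff_natAbs_eq, Int.natAbs_natCast] at hu
    exact hℓ.out.one_lt.ne' hu
  omega

/-- **`12 ∤ ord_ℓ(2¹²·3⁹·d²)` at every prime `ℓ ∣ d` of a fundamental discriminant `d`**: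
`ord_ℓ = 2` for `ℓ ≥ 5`, `11` for `ℓ = 3`, and `16` or `18` for `ℓ = 2` (then `4 ∣ d`,
`ord₂ d ∈ {2, 3}`). [folklore] -/
theorem not_twelve_dvd_padicValInt_Δ_sexticModel {d : ℤ}
    (h1 : (d % 4 = 1 ∧ Squarefree d ∧ d ≠ 1) ∨
      (4 ∣ d ∧ (d / 4 % 4 = 2 ∨ d / 4 % 4 = 3) ∧ Squarefree (d / 4)))
    (ℓ : ℕ) [hℓ : Fact ℓ.Prime] (hℓd : (ℓ : ℤ) ∣ d) :
    ¬ 12 ∣ padicValInt ℓ (-(2 ^ 12 * 3 ^ 9 * d ^ 2)) := by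
  have hℓP : ℓ.Prime := hℓ.out
  have hd0 : d ≠ 0 := by
    rcases h1 with ⟨-, hsq, -⟩ | ⟨-, -, hsq⟩
    · exact hsq.ne_zero
    · intro h; rw [h] at hsq; simp at hsq
  have hn0 : d.natAbs ≠ 0 := Int.natAbs_ne_zero.mpr hd0
  -- rewrite the valuation as a natural-number valuation
  have hnat : padicValInt ℓ (-(2 ^ 12 * 3 ^ 9 * d ^ 2)) =
      12 * padicValNat ℓ 2 + 9 * padicValNat ℓ 3 + 2 * padicValNat ℓ d.natAbs := by
    rw [padicValInt, Int.natAbs_neg, Int.natAbs_mul, Int.natAbs_mul, Int.natAbs_pow,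
      Int.natAbs_pow, Int.natAbs_pow]
    simp only [Int.reduceAbs]
    rw [padicValNat.mul (by positivity) (pow_ne_zero _ hn0),
      padicValNat.mul (by positivity) (by positivity), padicValNat.pow, padicValNat.pow,
      padicValNat.pow]
  rw [hnat]
  have h2pow : padicValNat ℓ 2 = if ℓ = 2 then 1 else 0 := by
    split_ifs with h
    · subst h; exact padicValNat_self
    · exact padicValNat_primes h
  have h3pow : padicValNat ℓ 3 = if ℓ = 3 then 1 else 0 := by
    split_ifs with h
    · subst h; exact padicValNat_self
    · exact padicValNat_primes h
  rw [h2pow, h3pow]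
  rcases h1 with ⟨h4, hsq, -⟩ | ⟨h4, hm4, hsq⟩
  · -- `d ≡ 1 (mod 4)`, squarefree: `ℓ` is odd and `ord_ℓ d = 1`
    have hv : padicValNat ℓ d.natAbs = 1 := padicValNat_natAbs_eq_one_of_squarefree hsq ℓ hℓd
    have hℓ2 : ℓ ≠ 2 := by
      rintro rfl
      obtain ⟨k, hk⟩ := hℓd
      omega
    rw [hv, if_neg hℓ2]
    split_ifs <;> omega
  · -- `d = 4m`, `m ≡ 2, 3 (mod 4)` squarefree
    obtain ⟨m, rfl⟩ := h4
    have hm : (4 * m) / 4 = m := by omega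
    rw [hm] at hm4 hsq
    have hm0 : m.natAbs ≠ 0 := Int.natAbs_ne_zero.mpr hsq.ne_zero
    have hsplit : padicValNat ℓ (4 * m).natAbs = padicValNat ℓ 4 + padicValNat ℓ m.natAbs := by
      rw [Int.natAbs_mul, show (4 : ℤ).natAbs = 4 from rfl, padicValNat.mul (by norm_num) hm0]
    rw [hsplit]
    by_cases hℓ2 : ℓ = 2
    · subst hℓ2
      have h4v : padicValNat 2 4 = 2 := by
        rw [show (4 : ℕ) = 2 ^ 2 by norm_num]; exact padicValNat.prime_pow 2
      -- `ord₂ m ≤ 1` since `m` is squarefree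
      have hvm : padicValNat 2 m.natAbs ≤ 1 := by
        by_contra h
        have hsq4 : 2 ^ 2 ∣ m.natAbs := (padicValNat_dvd_iff_le hm0).mpr (by omega)
        have hsq' : (2 : ℤ) * 2 ∣ m := by
          have := Int.natCast_dvd.mpr hsq4
          simpa using this
        have hu := hsq 2 hsq'
        rw [Int.isUnit_iff_natAbs_eq] at hu
        simp at hu
      rw [h4v, if_pos rfl, if_neg (by norm_num)]
      omega
    · have hℓodd : ¬ (ℓ : ℤ) ∣ 4 := by
        intro h
        have h' : ℓ ∣ 2 ^ 2 := by exact_mod_cast h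
        exact hℓ2 ((Nat.prime_dvd_prime_iff_eq hℓP Nat.prime_two).mp (hℓP.dvd_of_dvd_pow h'))
      have hℓm : (ℓ : ℤ) ∣ m := by
        have hprime : Prime (ℓ : ℤ) := Nat.prime_iff_prime_int.mp hℓP
        exact (hprime.dvd_or_dvd hℓd).resolve_left hℓodd
      have hv : padicValNat ℓ m.natAbs = 1 := padicValNat_natAbs_eq_one_of_squarefree hsq ℓ hℓm
      have h4v : padicValNat ℓ 4 = 0 := padicValNat.eq_zero_of_not_dvd (by exact_mod_cast hℓodd)
      rw [hv, h4v, if_neg hℓ2]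
      split_ifs <;> omega

/-- **Every prime factor of a fundamental `d` is a bad prime of `E_d`**: for `W ≅_ℚ y² = x³ − 432d`
globally minimal, `ℓ ∣ d` ⟹ `ℓ ∣ N(W)` (`ℓ ∣ Δ_min(W)`, hence bad reduction; Silverman VII.5.1(a)).
Kriz–Li, proof of Thm. 10.6: "`E_d` has additive reduction exactly at the prime factors of `3d`"
(the inclusion used here). [cite: KrizLi2019, §10.2 (sentence before Thm. 10.6)] [cite: SilvermanAEC2009, VII.5 Prop. 5.1(a)] -/
theorem dvd_conductorNorm_of_dvd {d : ℤ} (W : WeierstrassCurve ℚ) [W.IsElliptic]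
    [W.IsGloballyMinimal]
    (hW : ∃ C : VariableChange ℚ, C • W = ({ a₁ := 0, a₂ := 0, a₃ := 0, a₄ := 0, a₆ := -432 * d } :
      WeierstrassCurve ℚ))
    (h1 : (d % 4 = 1 ∧ Squarefree d ∧ d ≠ 1) ∨
      (4 ∣ d ∧ (d / 4 % 4 = 2 ∨ d / 4 % 4 = 3) ∧ Squarefree (d / 4)))
    (ℓ : ℕ) [Fact ℓ.Prime] (hℓd : (ℓ : ℤ) ∣ d) : ℓ ∣ W.conductorNorm ℤ := by
  obtain ⟨C, hC⟩ := hW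
  have hM : (C • W).Δ = ((-(2 ^ 12 * 3 ^ 9 * d ^ 2) : ℤ) : ℚ) := by rw [hC, Δ_sexticModel]
  have hdvd := dvd_minimalDiscriminantInt_of_smul_Δ_eq W C hM ℓ
    (not_twelve_dvd_padicValInt_Δ_sexticModel h1 ℓ hℓd)
  exact (W.dvd_conductorNorm_iff_not_hasGoodReductionAtPrime ℓ).mpr
    (not_hasGoodReductionAtPrime_of_dvd_minimalDiscriminantInt W ℓ hdvd)

/-- **Heegner for `3N(E_d)` ⟹ Heegner for `3|d|`** (every prime of `3d` divides `3N(E_d)`).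
[cite: KrizLi2019, §10.2 (sentence before Thm. 10.6)] -/
theorem satisfiesHeegnerHypothesis_three_mul_natAbs {d : ℤ} (W : WeierstrassCurve ℚ) [W.IsElliptic]
    [W.IsGloballyMinimal]
    (hW : ∃ C : VariableChange ℚ, C • W = ({ a₁ := 0, a₂ := 0, a₃ := 0, a₄ := 0, a₆ := -432 * d } :
      WeierstrassCurve ℚ))
    (h1 : (d % 4 = 1 ∧ Squarefree d ∧ d ≠ 1) ∨
      (4 ∣ d ∧ (d / 4 % 4 = 2 ∨ d / 4 % 4 = 3) ∧ Squarefree (d / 4)))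
    {K : Type} [Field K] (hH : SatisfiesHeegnerHypothesis (3 * W.conductorNorm ℤ) K) :
    SatisfiesHeegnerHypothesis (3 * d.natAbs) K := by
  intro p hp hpd
  haveI : Fact p.Prime := ⟨hp⟩
  rcases (Nat.Prime.dvd_mul hp).mp hpd with h3 | hd
  · exact hH p hp (dvd_mul_of_dvd_left h3 _)
  · exact hH p hp (dvd_mul_of_dvd_right
      (dvd_conductorNorm_of_dvd W hW h1 p (Int.natCast_dvd.mpr hd)) _)


/-! ### §2. Side condition (ii): the twisted equation is minimal at `3`, so `ord₃ u(Cd) = 0` -/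

/-- `9 ∤ d` for a fundamental discriminant `d`. [folklore] -/
theorem not_nine_dvd_of_fundamental {d : ℤ}
    (h1 : (d % 4 = 1 ∧ Squarefree d ∧ d ≠ 1) ∨
      (4 ∣ d ∧ (d / 4 % 4 = 2 ∨ d / 4 % 4 = 3) ∧ Squarefree (d / 4))) :
    ¬ (3 : ℤ) ^ 2 ∣ d := by
  intro h9
  rcases h1 with ⟨-, hsq, -⟩ | ⟨h4, -, hsq⟩
  · have hu := hsq 3 (by rw [← sq]; exact h9)
    rw [Int.isUnit_iff_natAbs_eq] at hu
    simp at hu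
  · obtain ⟨m, rfl⟩ := h4
    have hm : (4 * m) / 4 = m := by omega
    rw [hm] at hsq
    have h9m : (3 : ℤ) * 3 ∣ m := by
      have h : (9 : ℤ) ∣ 4 * m := by simpa using h9
      have : (9 : ℤ) ∣ m := by omega
      simpa using this
    have hu := hsq 3 h9m
    rw [Int.isUnit_iff_natAbs_eq] at hu
    simp at hu

/-- **`ord₃ Δ(W) ≤ 11` for a globally minimal `W ≅_ℚ y² = x³ − 432d`** (`d` fundamental): the
displayed model is integral with `ord₃ Δ = 9 + 2·ord₃ d ≤ 11`, and a minimal equation has the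
least `ord₃ Δ` (Silverman VII.1). In the value group: `exp(−12) < v₃(Δ(W))`.
[cite: SilvermanAEC2009, VII.1 (definition of minimality) and Remark 1.1] -/
theorem exp_neg_twelve_lt_valuation_Δ {d : ℤ} (W : WeierstrassCurve ℚ) [W.IsElliptic]
    [W.IsGloballyMinimal]
    (hW : ∃ C : VariableChange ℚ, C • W = ({ a₁ := 0, a₂ := 0, a₃ := 0, a₄ := 0, a₆ := -432 * d } :
      WeierstrassCurve ℚ))
    (h1 : (d % 4 = 1 ∧ Squarefree d ∧ d ≠ 1) ∨
      (4 ∣ d ∧ (d / 4 % 4 = 2 ∨ d / 4 % 4 = 3) ∧ Squarefree (d / 4)))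
    (v : HeightOneSpectrum (𝓞 ℚ)) (hv : ((Rat.HeightOneSpectrum.primesEquiv v : Nat.Primes) : ℕ) = 3) :
    WithZero.exp (-12 : ℤ) < v.valuation ℚ W.Δ := by
  obtain ⟨C, hC⟩ := hW
  -- the displayed model is `v`-integral
  have hMint : (C • W).IsIntegralAt v := by
    rw [hC]
    apply isIntegralAt_of_valuation_le_one
    · simp
    · simp
    · simp
    · simp
    · have h := valuation_ringOfIntegers_intCast_le_one v (-432 * d)
      push_cast at h
      exact h
  have hle := valuation_Δ_smul_le_of_isMinimalAt v (IsGloballyMinimal.isMinimalAt W v) C hMint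
  rw [hC, Δ_sexticModel] at hle
  refine lt_of_lt_of_le ?_ hle
  -- `v(−2¹²3⁹d²) = exp(−9)·v(d)² ≥ exp(−11)`
  have hv3 : v.valuation ℚ (3 : ℚ) = WithZero.exp (-1 : ℤ) := by
    have h := valuation_ringOfIntegers_natCast_primesEquiv v
    rw [hv] at h
    exact_mod_cast h
  have hv2 : v.valuation ℚ (2 : ℚ) = 1 := by
    have h := valuation_ringOfIntegers_intCast_eq_one v (n := 2) (by rw [hv]; decide)
    exact_mod_cast h
  have hvd : WithZero.exp (-1 : ℤ) ≤ v.valuation ℚ (d : ℚ) := by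
    by_cases h3d : (3 : ℤ) ∣ d
    · have h := valuation_ringOfIntegers_intCast_eq_exp_neg_one v (D := d) (by rw [hv]; exact h3d)
        (by rw [hv]; exact not_nine_dvd_of_fundamental h1)
      exact h.ge
    · rw [valuation_ringOfIntegers_intCast_eq_one v (n := d) (by rw [hv]; exact h3d),
        ← WithZero.exp_zero]
      exact WithZero.exp_le_exp.mpr (by norm_num)
  have hcalc : v.valuation ℚ (((-(2 ^ 12 * 3 ^ 9 * d ^ 2) : ℤ) : ℚ)) =
      WithZero.exp (-9 : ℤ) * (v.valuation ℚ (d : ℚ)) ^ 2 := by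
    rw [Int.cast_neg, Int.cast_mul, Int.cast_mul, Int.cast_pow, Int.cast_pow, Int.cast_pow,
      Int.cast_ofNat, Int.cast_ofNat, Valuation.map_neg, map_mul, map_mul, map_pow, map_pow,
      map_pow, hv2, hv3, one_pow, one_mul, ← WithZero.exp_nsmul]
    norm_num
  rw [hcalc]
  calc WithZero.exp (-12 : ℤ) < WithZero.exp (-9 : ℤ) * (WithZero.exp (-1 : ℤ)) ^ 2 := by
        rw [← WithZero.exp_nsmul, ← WithZero.exp_add]
        exact WithZero.exp_lt_exp.mpr (by norm_num)
    _ ≤ WithZero.exp (-9 : ℤ) * (v.valuation ℚ (d : ℚ)) ^ 2 :=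
        mul_le_mul' le_rfl (pow_le_pow_left' hvd 2)

/-- **Side condition (ii), PROVED for the family: `ord₃ u(Cd) = 0`.** For `W ≅_ℚ E_d` globally
minimal (`d` fundamental), `D ∈ ℤ` with `3 ∤ D`, and ANY globally minimal model
`Wd = Cd • W^{(D)}`: the twisted equation `W^{(D)}` (Silverman X.5.4's model) is `3`-integral with
`ord₃ Δ(W^{(D)}) = ord₃ (D⁶ Δ(W)) = ord₃ Δ(W) ≤ 11 < 12`, hence minimal at `3` (AEC VII.1 Rem. 1.1);
two `3`-minimal equations differ by a `3`-adic unit (AEC VII.1.3(b); eisenstein-p2's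
`X2.valuation_u_eq_one_of_isMinimalAt_smul`). [cite: SilvermanAEC2009, VII.1 Prop. 1.3(b) and Remark 1.1] -/
theorem padicValRat_u_eq_zero_of_smul_quadraticTwist {d : ℤ} (W : WeierstrassCurve ℚ) [W.IsElliptic]
    [W.IsGloballyMinimal]
    (hW : ∃ C : VariableChange ℚ, C • W = ({ a₁ := 0, a₂ := 0, a₃ := 0, a₄ := 0, a₆ := -432 * d } :
      WeierstrassCurve ℚ))
    (h1 : (d % 4 = 1 ∧ Squarefree d ∧ d ≠ 1) ∨
      (4 ∣ d ∧ (d / 4 % 4 = 2 ∨ d / 4 % 4 = 3) ∧ Squarefree (d / 4)))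
    {D : ℤ} (hD0 : D ≠ 0) (hD3 : ¬ (3 : ℤ) ∣ D)
    (Wd : WeierstrassCurve ℚ) [Wd.IsElliptic] [Wd.IsGloballyMinimal] (Cd : VariableChange ℚ)
    (hWd : Cd • W.quadraticTwist (D : ℚ) = Wd) : padicValRat 3 (Cd.u : ℚ) = 0 := by
  haveI : Fact (Nat.Prime 3) := ⟨Nat.prime_three⟩
  obtain ⟨v, hv⟩ : ∃ v : HeightOneSpectrum (𝓞 ℚ),
      ((Rat.HeightOneSpectrum.primesEquiv v : Nat.Primes) : ℕ) = 3 :=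
    ⟨Rat.HeightOneSpectrum.primesEquiv.symm ⟨3, Nat.prime_three⟩, by rw [Equiv.apply_symm_apply]⟩
  have hD0' : (D : ℚ) ≠ 0 := by exact_mod_cast hD0
  haveI : (W.quadraticTwist (D : ℚ)).IsElliptic := W.isElliptic_quadraticTwist hD0'
  -- integrality of the coefficients of `W`
  set M : WeierstrassCurve ℤ := integralModelInt W with hM
  have hWM : M.map (Int.castRingHom ℚ) = W := map_integralModelInt W
  have hWb₂ : W.b₂ = (M.b₂ : ℚ) := by
    rw [← congrArg WeierstrassCurve.b₂ hWM, map_b₂, eq_intCast]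
  have hWb₄ : W.b₄ = (M.b₄ : ℚ) := by
    rw [← congrArg WeierstrassCurve.b₄ hWM, map_b₄, eq_intCast]
  have hWb₆ : W.b₆ = (M.b₆ : ℚ) := by
    rw [← congrArg WeierstrassCurve.b₆ hWM, map_b₆, eq_intCast]
  have hv4 : v.valuation ℚ (4 : ℚ) = 1 := by
    have h := valuation_ringOfIntegers_intCast_eq_one v (n := 4) (by rw [hv]; decide)
    simpa using h
  have hv2 : v.valuation ℚ (2 : ℚ) = 1 := by
    have h := valuation_ringOfIntegers_intCast_eq_one v (n := 2) (by rw [hv]; decide)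
    simpa using h
  have hvD : v.valuation ℚ (D : ℚ) = 1 :=
    valuation_ringOfIntegers_intCast_eq_one v (by rw [hv]; exact hD3)
  have hvb₂ : v.valuation ℚ W.b₂ ≤ 1 := hWb₂ ▸ valuation_ringOfIntegers_intCast_le_one v _
  have hvb₄ : v.valuation ℚ W.b₄ ≤ 1 := hWb₄ ▸ valuation_ringOfIntegers_intCast_le_one v _
  have hvb₆ : v.valuation ℚ W.b₆ ≤ 1 := hWb₆ ▸ valuation_ringOfIntegers_intCast_le_one v _
  set X : WeierstrassCurve ℚ := W.quadraticTwist (D : ℚ) with hXdef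
  have hXint : X.IsIntegralAt v := by
    refine isIntegralAt_of_valuation_le_one (W := X) (v := v) ?_ ?_ ?_ ?_ ?_
    · simp [hXdef]
    · simp only [hXdef, quadraticTwist_a₂, map_div₀, map_mul, hv4, hvD, div_one, one_mul]
      exact hvb₂
    · simp [hXdef]
    · simp only [hXdef, quadraticTwist_a₄, map_div₀, map_mul, map_pow, hv2, hvD, div_one,
        one_mul, one_pow]
      exact hvb₄
    · simp only [hXdef, quadraticTwist_a₆, map_div₀, map_mul, map_pow, hv4, hvD, div_one,
        one_mul, one_pow]
      exact hvb₆
  -- `v(Δ(X)) = v(Δ(W)) > exp(−12)`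
  have hXΔ : WithZero.exp (-12 : ℤ) < v.valuation ℚ X.Δ := by
    rw [hXdef, quadraticTwist_Δ, map_mul, map_pow, hvD, one_pow, one_mul]
    exact exp_neg_twelve_lt_valuation_Δ W hW h1 v hv
  have hXmin : X.IsMinimalAt v := isMinimalAt_of_lt_valuation_Δ_holds hXint hXΔ
  have hCX : (Cd • X).IsMinimalAt v := by
    rw [hXdef, hWd]; exact IsGloballyMinimal.isMinimalAt Wd v
  have hu := X2.valuation_u_eq_one_of_isMinimalAt_smul X Cd v hXmin hCX
  exact X2.padicValRat_eq_zero_of_valuation_eq_one v 3 hv (Units.ne_zero Cd.u) hu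

/-! ### §3. Small bookkeeping: CM of `W ≅ E_d`, `3 ∤ #μ(K)` -/

/-- `W ≅_ℚ y² = x³ − 432d` has `c₄ = 0`, hence `j = 0` and complex multiplication (tree theorem
`hasCM_of_j_eq_zero`). [folklore] -/
theorem hasCM_of_sextic {d : ℤ} (W : WeierstrassCurve ℚ) [W.IsElliptic]
    (hW : ∃ C : VariableChange ℚ, C • W = ({ a₁ := 0, a₂ := 0, a₃ := 0, a₄ := 0, a₆ := -432 * d } :
      WeierstrassCurve ℚ)) : W.HasCM := by
  obtain ⟨C, hC⟩ := hW
  have h : (C • W).c₄ = ((C.u⁻¹ : ℚˣ) : ℚ) ^ 4 * W.c₄ := WeierstrassCurve.variableChange_c₄ W C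
  have h0 : (C • W).c₄ = 0 := by rw [hC]; exact (Δ_c₄_mordell _).2
  rw [h0] at h
  rcases mul_eq_zero.mp h.symm with h1 | h1
  · exact absurd h1 (pow_ne_zero _ (Units.ne_zero _))
  · exact WeierstrassCurve.hasCM_of_j_eq_zero W (W.j_eq_zero h1)

/-- If `3` splits in the imaginary quadratic field `K` then `3 ∤ d_K`, so `d_K ≠ −3` and
`3 ∤ #μ(K)` — side condition (iii) of `KrizLi2019.bsdp_three_of_thm1010`. [cite: Cox2013, §7.A] -/
theorem not_three_dvd_torsionOrder_of_split {K : Type} [Field K] [NumberField K]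
    (hK : IsImaginaryQuadratic K) (h3 : SatisfiesHeegnerHypothesis 3 K) :
    ¬ (3 : ℤ) ∣ NumberField.discr K ∧ ¬ 3 ∣ Units.torsionOrder K := by
  have h3dK : ¬ (3 : ℤ) ∣ NumberField.discr K := by
    simpa using not_dvd_discr_of_split hK Nat.prime_three (by norm_num) h3
  exact ⟨h3dK, not_three_dvd_torsionOrder hK.1 fun h => h3dK (by rw [h]; norm_num)⟩

end Summit.BirchSwinnertonDyer.Rank1Residual.X12.SexticTwistFamily

end
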